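/-
Copyright (c) 2026. All rights reserved.
Released under Apache 2.0 license as described in the file LICENSE.
Authors: abc-iut cell, seat abc-iut-L6-t6 (bridge for abc-iut-L6-t4's `GlobalFrobenioidModels.lean`,
MERGE-MAP §1 row «Ex 3.6 (i)/(ii) is a Frobenioid»; recipe of abc-iut-L6-d3).
-/
import Literature.IUT.LogThetaLattice.GlobalFrobenioidModelsProofs
import Literature.AlgebraicGeometry.Frobenioids.ModelFrobenioidFunctor
import HarnessLib

/-!
# [IUTchIII] Example 3.6 (ii): the category `𝓕⊛_𝔪𝔬𝔡` and the data of its model Frobenioid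

S. Mochizuki, *Inter-universal Teichmüller Theory III*, kurims manuscript (May 2020), Example 3.6 (ii),
pp. 107–108 [claim key Mochizuki2012, status disputed (D-0012)]: "Thus, `𝓕⊛_𝔪𝔬𝔡` forms a category. In
fact, one verifies immediately that, from the point of view of the theory of Frobenioids developed in
[FrdI], [FrdII], `𝓕⊛_𝔪𝔬𝔡` admits a natural Frobenioid structure [cf. [FrdI], Definition 1.3], for which
the base category is the category with precisely one arrow. Relative to this Frobenioid structure, the
elementary morphisms are precisely the linear morphisms, and the positive integer '`n`' … is the
Frobenius degree of the morphism." (p. 108 l. 5–11).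

abc-iut-L6-t4 typed the objects `FrakObj` (`𝔍 = {𝔍_v}` ↔ finitely supported families of classes
`[λ_v] ∈ Γ_v`), the relations `FrakObj.IsElemHom` / `FrakObj.IsHom` and the tensor powers; the companion
`GlobalFrobenioidModelsProofs.lean` (abc-iut-L6-t6) proved the composition law `(m, g) ∘ (n, f) =
(n·m, g·f^m)`. This file CONSTRUCTS:
* the category `𝓕⊛_𝔪𝔬𝔡` as a Mathlib `Category` (`FrakCat`: morphisms = pairs `(n, f)` with
  `FrakObj.IsHom`), and the "evident" group structure on families of classes (tensor product of
  fractional ideals = addition of classes);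
* the data of the MODEL FROBENIOID of [FrdI] Thm. 5.2 over the one-arrow base category to which
  `𝓕⊛_𝔪𝔬𝔡` will be compared (`GlobalFrobenioidModelsFrobenioid.lean`): base `𝒟 = ` the one-morphism
  category, divisor monoid `Φ(∗) :=` the effective families `{D_v ∈ Γ_v^{≥0}}` ("effective arithmetic
  divisors", `effDiv`), rational function monoid `𝔹(∗) := F^×_mod`, and `Div_𝔹(f) := (β_v(f))_v`
  (`divB`, valued in `Φ^gp` through `toGp`).
Hypotheses on the abstract value groups (all satisfied by `Γ_v = K_v^×/𝒪^×_{K_v}`, i.e. `ℤ` or `ℝ` with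
their nonnegative cones — abc-iut-L6-d1's `GlobalFrobenioidModelsPlaces.lean`): every `Γ_v` is generated
by `Γ_v^{≥0}` (so that classes are differences of effective ones) and every `f ∈ F^×` is a unit at
almost all `v` (`ModelHyps`). Nothing here takes a side on [IUTchIII] Cor. 3.12; typed ≠ endorsed.
-/

noncomputable section

namespace Literature.IUT.LogThetaLattice

namespace GlobalFrobenioidModels

open CategoryTheory Opposite Literature.AlgebraicGeometry.Frobenioids

universe u

variable {F : Type u} [Field F] {V : Type u} {Γ : V → Type u} [∀ v, AddCommGroup (Γ v)]
  {nonneg : ∀ v, AddSubmonoid (Γ v)} {β : ∀ v, Additive Fˣ →+ Γ v}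

/-! ### The "evident" group structure on families of classes (tensor products / inverses of `𝔍`) -/

namespace FrakObj

/-- `𝒪 = {𝒪_{K_v}}_v`, the trivial family (all classes `0`). ([IUTchIII] Ex 3.6 (ii) p.107) [claim: Mochizuki2012, status: disputed] -/
instance : Zero (FrakObj V Γ) := ⟨⟨fun _ => 0, by simp⟩⟩

/-- Tensor product of fractional-ideal families: classes add; the support of the sum lies in the union
of the supports. ([IUTchIII] Ex 3.6 (ii) p.107) [claim: Mochizuki2012, status: disputed] -/
instance : Add (FrakObj V Γ) :=
  ⟨fun J₁ J₂ => ⟨fun v => J₁.cls v + J₂.cls v, (J₁.finite.union J₂.finite).subset fun v hv => by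
    by_contra h
    simp only [Set.mem_union, Set.mem_setOf_eq, not_or, not_not] at h
    exact hv (by rw [h.1, h.2, add_zero])⟩⟩

/-- Inverse family `𝔍^{⊗(-1)}`. ([IUTchIII] Ex 3.6 (ii) p.107) [claim: Mochizuki2012, status: disputed] -/
instance : Neg (FrakObj V Γ) := ⟨fun J => ⟨fun v => -J.cls v, J.finite.subset fun v hv => by
    intro h; exact hv (by rw [h, neg_zero])⟩⟩

/-- `𝔍₁ ⊗ 𝔍₂^{⊗(-1)}`. ([IUTchIII] Ex 3.6 (ii) p.107) [claim: Mochizuki2012, status: disputed] -/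
instance : Sub (FrakObj V Γ) :=
  ⟨fun J₁ J₂ => ⟨fun v => J₁.cls v - J₂.cls v, (J₁.finite.union J₂.finite).subset fun v hv => by
    by_contra h
    simp only [Set.mem_union, Set.mem_setOf_eq, not_or, not_not] at h
    exact hv (by rw [h.1, h.2, sub_zero])⟩⟩

/-- `𝔍^{⊗n}`, `n ∈ ℕ` (abc-iut-L6-t4's `tensorPow`). ([IUTchIII] Ex 3.6 (ii) p.107) [claim: Mochizuki2012, status: disputed] -/
instance : SMul ℕ (FrakObj V Γ) := ⟨fun n J => J.tensorPow n⟩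

/-- `𝔍^{⊗n}`, `n ∈ ℤ` (abc-iut-L6-t4's `tensorPow`). ([IUTchIII] Ex 3.6 (ii) p.107) [claim: Mochizuki2012, status: disputed] -/
instance : SMul ℤ (FrakObj V Γ) := ⟨fun n J => J.tensorPow n⟩

/-- The classes of a sum. ([IUTchIII] Ex 3.6 (ii) p.107) [claim: Mochizuki2012, status: disputed] -/
@[simp] theorem cls_add (J₁ J₂ : FrakObj V Γ) (v : V) : (J₁ + J₂).cls v = J₁.cls v + J₂.cls v := rfl

/-- The classes of the trivial family. ([IUTchIII] Ex 3.6 (ii) p.107) [claim: Mochizuki2012, status: disputed] -/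
@[simp] theorem cls_zero (v : V) : (0 : FrakObj V Γ).cls v = 0 := rfl

/-- The classes of the inverse family. ([IUTchIII] Ex 3.6 (ii) p.107) [claim: Mochizuki2012, status: disputed] -/
@[simp] theorem cls_neg (J : FrakObj V Γ) (v : V) : (-J).cls v = -J.cls v := rfl

/-- The classes of a difference. ([IUTchIII] Ex 3.6 (ii) p.107) [claim: Mochizuki2012, status: disputed] -/
@[simp] theorem cls_sub (J₁ J₂ : FrakObj V Γ) (v : V) : (J₁ - J₂).cls v = J₁.cls v - J₂.cls v := rfl

/-- The classes of `𝔍^{⊗n}`, `n ∈ ℤ`. ([IUTchIII] Ex 3.6 (ii) p.107) [claim: Mochizuki2012, status: disputed] -/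
@[simp] theorem cls_zsmul (n : ℤ) (J : FrakObj V Γ) (v : V) : (n • J).cls v = n • J.cls v := rfl

/-- The classes of `𝔍^{⊗n}`, `n ∈ ℕ`. ([IUTchIII] Ex 3.6 (ii) p.107) [claim: Mochizuki2012, status: disputed] -/
@[simp] theorem cls_nsmul (n : ℕ) (J : FrakObj V Γ) (v : V) : (n • J).cls v = n • J.cls v := by
  show ((n : ℤ) • J.cls v) = n • J.cls v
  exact natCast_zsmul _ _

/-- Families of classes form an abelian group under tensor product ("evident notion of tensor powers",
p. 107 l. 38) — the group `⊕_v Γ_v` of finitely supported families. ([IUTchIII] Ex 3.6 (ii) p.107) [claim: Mochizuki2012, status: disputed] -/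
instance : AddCommGroup (FrakObj V Γ) :=
  Function.Injective.addCommGroup FrakObj.cls (fun _ _ h => FrakObj.ext_cls h) rfl (fun _ _ => rfl)
    (fun _ => rfl) (fun _ _ => rfl) (fun J n => funext fun v => cls_nsmul n J v) (fun _ _ => rfl)

/-- `n • 𝔍` is abc-iut-L6-t4's `𝔍^{⊗n}`. ([IUTchIII] Ex 3.6 (ii) p.107) [claim: Mochizuki2012, status: disputed] -/
theorem zsmul_eq_tensorPow (n : ℤ) (J : FrakObj V Γ) : n • J = J.tensorPow n := rfl

end FrakObj

/-! ### The category `𝓕⊛_𝔪𝔬𝔡` -/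

variable (F V Γ nonneg β) in
/-- The objects of the category `𝓕⊛_𝔪𝔬𝔡`: abc-iut-L6-t4's `FrakObj V Γ`, recorded together with the field
`F_mod`, the cones `Γ_v^{≥0}` and the homomorphisms `β_v` that determine the morphisms (Ex. 3.6 (ii),
p. 107). ([IUTchIII] Ex 3.6 (ii) p.107) [claim: Mochizuki2012, status: disputed] -/
@[nolint unusedArguments]
def FrakCat (_nonneg : ∀ v, AddSubmonoid (Γ v)) (_β : ∀ v, Additive Fˣ →+ Γ v) : Type u := FrakObj V Γ

namespace FrakCat

/-- An object of `𝓕⊛_𝔪𝔬𝔡` from a family of fractional ideals. ([IUTchIII] Ex 3.6 (ii) p.107) [claim: Mochizuki2012, status: disputed] -/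
def of (J : FrakObj V Γ) : FrakCat F V Γ nonneg β := J

/-- The underlying family of an object of `𝓕⊛_𝔪𝔬𝔡`. ([IUTchIII] Ex 3.6 (ii) p.107) [claim: Mochizuki2012, status: disputed] -/
def obj (X : FrakCat F V Γ nonneg β) : FrakObj V Γ := X

/-- `of`/`obj` round trip. ([IUTchIII] Ex 3.6 (ii) p.107) [claim: Mochizuki2012, status: disputed] -/
@[simp] theorem obj_of (J : FrakObj V Γ) : (of J : FrakCat F V Γ nonneg β).obj = J := rfl

/-- **A morphism `𝔍₁ → 𝔍₂` of `𝓕⊛_𝔪𝔬𝔡`**: "a positive integer `n` and an elementary morphism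
`(𝔍₁)^{⊗n} → 𝔍₂`", i.e. an `f ∈ F^×_mod` with `f · 𝔍_{1,v}^{n} ⊆ 𝔍_{2,v}` for all `v` (p. 108 l. 3–4;
abc-iut-L6-t4's `FrakObj.IsHom`). ([IUTchIII] Ex 3.6 (ii) p.108) [claim: Mochizuki2012, status: disputed] -/
@[ext] structure Hom (X Y : FrakCat F V Γ nonneg β) : Type u where
  /-- the positive integer `n` (the Frobenius degree) -/
  deg : ℕ+
  /-- the element `f ∈ F^×_mod` (the elementary morphism `𝔍₁^{⊗n} → 𝔍₂`) -/
  fn : Fˣ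
  /-- `f` is integral with respect to `𝔍₁^{⊗n}` and `𝔍₂` -/
  isHom : FrakObj.IsHom (nonneg := nonneg) (β := β) X.obj Y.obj deg fn

/-- **`𝓕⊛_𝔪𝔬𝔡` is a category** ("There is an evident notion of composition of morphisms. Thus, `𝓕⊛_𝔪𝔬𝔡`
forms a category", p. 108 l. 4–5): `(n, f)` followed by `(m, g)` is `(m·n, g·f^m)` (composition law
PROVED in `GlobalFrobenioidModelsProofs.lean`, `FrakObj.isHom_comp`). ([IUTchIII] Ex 3.6 (ii) p.108) [claim: Mochizuki2012, status: disputed] -/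
instance : Category.{u} (FrakCat F V Γ nonneg β) where
  Hom X Y := Hom X Y
  id X := ⟨1, 1, FrakObj.isHom_one_one X.obj⟩
  comp φ ψ := ⟨ψ.deg * φ.deg, ψ.fn * φ.fn ^ (ψ.deg : ℕ), by
    rw [mul_comm]
    exact FrakObj.isHom_comp φ.isHom ψ.isHom⟩
  id_comp φ := by
    apply Hom.ext
    · exact mul_one _
    · show φ.fn * 1 ^ (φ.deg : ℕ) = φ.fn
      rw [one_pow, mul_one]
  comp_id φ := by
    apply Hom.ext
    · exact one_mul _
    · show 1 * φ.fn ^ ((1 : ℕ+) : ℕ) = φ.fn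
      rw [PNat.one_coe, pow_one, one_mul]
  assoc φ ψ χ := by
    apply Hom.ext
    · exact (mul_assoc _ _ _).symm
    · show χ.fn * (ψ.fn * φ.fn ^ (ψ.deg : ℕ)) ^ (χ.deg : ℕ) =
        χ.fn * ψ.fn ^ (χ.deg : ℕ) * φ.fn ^ ((χ.deg * ψ.deg : ℕ+) : ℕ)
      rw [mul_pow, ← pow_mul, PNat.mul_coe, mul_comm (χ.deg : ℕ) (ψ.deg : ℕ), mul_assoc]

/-- The Frobenius degree of a morphism of `𝓕⊛_𝔪𝔬𝔡`. ([IUTchIII] Ex 3.6 (ii) p.108) [claim: Mochizuki2012, status: disputed] -/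
abbrev deg {X Y : FrakCat F V Γ nonneg β} (φ : X ⟶ Y) : ℕ+ := Hom.deg φ

/-- The element `f ∈ F^×_mod` of a morphism of `𝓕⊛_𝔪𝔬𝔡`. ([IUTchIII] Ex 3.6 (ii) p.108) [claim: Mochizuki2012, status: disputed] -/
abbrev fn {X Y : FrakCat F V Γ nonneg β} (φ : X ⟶ Y) : Fˣ := Hom.fn φ

/-- Extensionality: a morphism of `𝓕⊛_𝔪𝔬𝔡` is the pair `(n, f)`. ([IUTchIII] Ex 3.6 (ii) p.108) [claim: Mochizuki2012, status: disputed] -/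
theorem hom_ext {X Y : FrakCat F V Γ nonneg β} {φ ψ : X ⟶ Y} (h₁ : deg φ = deg ψ) (h₂ : fn φ = fn ψ) :
    φ = ψ :=
  Hom.ext h₁ h₂

/-- The identity is `(1, 1)`. ([IUTchIII] Ex 3.6 (ii) p.108) [claim: Mochizuki2012, status: disputed] -/
@[simp] theorem deg_id (X : FrakCat F V Γ nonneg β) : deg (𝟙 X) = 1 := rfl

/-- The identity is `(1, 1)`. ([IUTchIII] Ex 3.6 (ii) p.108) [claim: Mochizuki2012, status: disputed] -/
@[simp] theorem fn_id (X : FrakCat F V Γ nonneg β) : fn (𝟙 X) = 1 := rfl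

/-- Frobenius degrees multiply under composition. ([IUTchIII] Ex 3.6 (ii) p.108) [claim: Mochizuki2012, status: disputed] -/
@[simp] theorem deg_comp {X Y Z : FrakCat F V Γ nonneg β} (φ : X ⟶ Y) (ψ : Y ⟶ Z) :
    deg (φ ≫ ψ) = deg ψ * deg φ := rfl

/-- The element of a composite: `g · f^m`. ([IUTchIII] Ex 3.6 (ii) p.108) [claim: Mochizuki2012, status: disputed] -/
@[simp] theorem fn_comp {X Y Z : FrakCat F V Γ nonneg β} (φ : X ⟶ Y) (ψ : Y ⟶ Z) :
    fn (φ ≫ ψ) = fn ψ * fn φ ^ (deg ψ : ℕ) := rfl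

/-- The integrality condition of a morphism, pointwise: `β_v(f) + n·[λ_{1,v}] - [λ_{2,v}] ∈ Γ_v^{≥0}`.
([IUTchIII] Ex 3.6 (ii) p.108) [claim: Mochizuki2012, status: disputed] -/
theorem mem_nonneg {X Y : FrakCat F V Γ nonneg β} (φ : X ⟶ Y) (v : V) :
    β v (Additive.ofMul (fn φ)) + ((deg φ : ℕ) : ℤ) • X.obj.cls v - Y.obj.cls v ∈ nonneg v :=
  Hom.isHom φ v

/-- A pair `(n, f)` satisfying the integrality condition is a morphism. ([IUTchIII] Ex 3.6 (ii) p.108) [claim: Mochizuki2012, status: disputed] -/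
def homMk {X Y : FrakCat F V Γ nonneg β} (n : ℕ+) (f : Fˣ)
    (h : FrakObj.IsHom (nonneg := nonneg) (β := β) X.obj Y.obj n f) : X ⟶ Y :=
  ⟨n, f, h⟩

/-- `deg (homMk n f h) = n`. ([IUTchIII] Ex 3.6 (ii) p.108) [claim: Mochizuki2012, status: disputed] -/
@[simp] theorem deg_homMk {X Y : FrakCat F V Γ nonneg β} (n : ℕ+) (f : Fˣ)
    (h : FrakObj.IsHom (nonneg := nonneg) (β := β) X.obj Y.obj n f) : deg (homMk n f h) = n := rfl

/-- `fn (homMk n f h) = f`. ([IUTchIII] Ex 3.6 (ii) p.108) [claim: Mochizuki2012, status: disputed] -/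
@[simp] theorem fn_homMk {X Y : FrakCat F V Γ nonneg β} (n : ℕ+) (f : Fˣ)
    (h : FrakObj.IsHom (nonneg := nonneg) (β := β) X.obj Y.obj n f) : fn (homMk n f h) = f := rfl

end FrakCat

/-! ### Hypotheses on the abstract local value groups -/

variable (nonneg β) in
/-- The standing properties of the local value groups `Γ_v = K_v^×/𝒪^×_{K_v}` and of `β_v` used to
exhibit the Frobenioid structure: `Γ_v` is generated by its nonnegative cone (every class is a
difference of effective ones), the cone is saturated and sharp, and every `f ∈ F^×_mod` is a `v`-unit
for almost all `v` (so that `(β_v(f))_v` is an arithmetic divisor). For a number field these are the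
familiar properties of `ℤ_{≥0} ⊆ ℤ` (`v` finite) and `ℝ_{≥0} ⊆ ℝ` (`v` archimedean).
([IUTchIII] Ex 3.6 (i) p.107) [claim: Mochizuki2012, status: disputed] -/
structure ModelHyps : Prop where
  /-- every class is a difference of two nonnegative classes -/
  directed : ∀ (v : V) (x : Γ v), ∃ a ∈ nonneg v, ∃ b ∈ nonneg v, x = a - b
  /-- `Γ_v^{≥0}` is saturated in `Γ_v` -/
  saturated : ∀ (v : V) (x : Γ v) (n : ℕ), 0 < n → n • x ∈ nonneg v → x ∈ nonneg v
  /-- `Γ_v^{≥0}` is sharp -/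
  sharp : ∀ (v : V) (x : Γ v), x ∈ nonneg v → -x ∈ nonneg v → x = 0
  /-- `β_v(f) = 0` for almost all `v` -/
  finite : ∀ f : Fˣ, {v | β v (Additive.ofMul f) ≠ 0}.Finite

/-! ### The divisor monoid `Φ(∗)`: effective families -/

variable (V Γ nonneg) in
/-- The monoid of EFFECTIVE families `{D_v ∈ Γ_v^{≥0}}_v` (the effective arithmetic divisors; the value
at the unique object of the divisor monoid `Φ` of the Frobenioid structure of `𝓕⊛_𝔪𝔬𝔡`).
([IUTchIII] Ex 3.6 (ii) p.108) [claim: Mochizuki2012, status: disputed] -/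
def effDiv : AddSubmonoid (FrakObj V Γ) where
  carrier := {D | ∀ v, D.cls v ∈ nonneg v}
  zero_mem' := fun v => (nonneg v).zero_mem
  add_mem' := fun ha hb v => (nonneg v).add_mem (ha v) (hb v)

/-- Membership in `effDiv`. ([IUTchIII] Ex 3.6 (ii) p.108) [claim: Mochizuki2012, status: disputed] -/
theorem mem_effDiv {D : FrakObj V Γ} : D ∈ effDiv V Γ nonneg ↔ ∀ v, D.cls v ∈ nonneg v := Iff.rfl

variable (V Γ nonneg) in
/-- `Φ(∗)` written multiplicatively (the tree's [FrdI] files use multiplicative monoids).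
([IUTchIII] Ex 3.6 (ii) p.108) [claim: Mochizuki2012, status: disputed] -/
abbrev EffDiv : Type u := Multiplicative (effDiv V Γ nonneg)

/-- `Φ(∗)` is cancellative. ([IUTchIII] Ex 3.6 (ii) p.108) [claim: Mochizuki2012, status: disputed] -/
instance : IsLeftCancelAdd (effDiv V Γ nonneg) :=
  ⟨fun _ _ _ h => Subtype.ext (add_left_cancel (congrArg Subtype.val h))⟩

/-- `Φ(∗)` is cancellative. ([IUTchIII] Ex 3.6 (ii) p.108) [claim: Mochizuki2012, status: disputed] -/
instance : IsRightCancelAdd (effDiv V Γ nonneg) :=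
  ⟨fun _ _ _ h => Subtype.ext (add_right_cancel (congrArg Subtype.val h))⟩

/-- `Φ(∗)` is cancellative. ([IUTchIII] Ex 3.6 (ii) p.108) [claim: Mochizuki2012, status: disputed] -/
instance : IsCancelAdd (effDiv V Γ nonneg) where

/-! ### Classes as elements of `Φ^gp`: `toGp` -/

section ToGp

variable (H : ModelHyps nonneg β)
include H

/-- Directedness with a normalised choice at `0`: every class is `a - b` with `a, b ≥ 0`, and `a = 0`
when the class is `0`. ([IUTchIII] Ex 3.6 (ii) p.107) [claim: Mochizuki2012, status: disputed] -/
theorem directed' (v : V) (x : Γ v) :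
    ∃ a ∈ nonneg v, ∃ b ∈ nonneg v, x = a - b ∧ (x = 0 → a = 0) := by
  by_cases hx : x = 0
  · exact ⟨0, (nonneg v).zero_mem, 0, (nonneg v).zero_mem, by rw [hx, sub_zero], fun _ => rfl⟩
  · obtain ⟨a, ha, b, hb, hab⟩ := H.directed v x
    exact ⟨a, ha, b, hb, hab, fun h => (hx h).elim⟩

/-- A chosen effective "positive part" `D⁺` of a family of classes (`D = D⁺ - D⁻`, using that `Γ_v` is
generated by `Γ_v^{≥0}`). ([IUTchIII] Ex 3.6 (ii) p.107) [claim: Mochizuki2012, status: disputed] -/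
def posPart (D : FrakObj V Γ) : FrakObj V Γ where
  cls v := (directed' H v (D.cls v)).choose
  finite := D.finite.subset fun v hv => by
    intro h0
    exact hv ((directed' H v (D.cls v)).choose_spec.2.choose_spec.2.2 h0)

/-- The matching effective "negative part" `D⁻`. ([IUTchIII] Ex 3.6 (ii) p.107) [claim: Mochizuki2012, status: disputed] -/
def negPart (D : FrakObj V Γ) : FrakObj V Γ where
  cls v := (directed' H v (D.cls v)).choose_spec.2.choose
  finite := D.finite.subset fun v hv => by
    intro h0
    have h1 := (directed' H v (D.cls v)).choose_spec.2.choose_spec.2.1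
    have h2 := (directed' H v (D.cls v)).choose_spec.2.choose_spec.2.2 h0
    apply hv
    show (directed' H v (D.cls v)).choose_spec.2.choose = 0
    rw [← sub_eq_zero.mp (h1.symm.trans h0)]
    exact h2

/-- `D⁺` is effective. ([IUTchIII] Ex 3.6 (ii) p.107) [claim: Mochizuki2012, status: disputed] -/
theorem posPart_mem (D : FrakObj V Γ) : posPart H D ∈ effDiv V Γ nonneg :=
  fun v => (directed' H v (D.cls v)).choose_spec.1

/-- `D⁻` is effective. ([IUTchIII] Ex 3.6 (ii) p.107) [claim: Mochizuki2012, status: disputed] -/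
theorem negPart_mem (D : FrakObj V Γ) : negPart H D ∈ effDiv V Γ nonneg :=
  fun v => (directed' H v (D.cls v)).choose_spec.2.choose_spec.1

/-- `D = D⁺ - D⁻`. ([IUTchIII] Ex 3.6 (ii) p.107) [claim: Mochizuki2012, status: disputed] -/
theorem posPart_sub_negPart (D : FrakObj V Γ) : posPart H D - negPart H D = D :=
  FrakObj.ext_cls (funext fun v => ((directed' H v (D.cls v)).choose_spec.2.choose_spec.2.1).symm)

omit H in
/-- `of(a) / of(b)` in `Φ^gp` only depends on `a - b`. ([IUTchIII] Ex 3.6 (ii) p.108) [claim: Mochizuki2012, status: disputed] -/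
theorem of_div_of_eq {a b a' b' : FrakObj V Γ} (ha : a ∈ effDiv V Γ nonneg) (hb : b ∈ effDiv V Γ nonneg)
    (ha' : a' ∈ effDiv V Γ nonneg) (hb' : b' ∈ effDiv V Γ nonneg) (h : a - b = a' - b') :
    Algebra.GrothendieckGroup.of (Multiplicative.ofAdd (⟨a, ha⟩ : effDiv V Γ nonneg)) /
        Algebra.GrothendieckGroup.of (Multiplicative.ofAdd (⟨b, hb⟩ : effDiv V Γ nonneg)) =
      Algebra.GrothendieckGroup.of (Multiplicative.ofAdd (⟨a', ha'⟩ : effDiv V Γ nonneg)) /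
        Algebra.GrothendieckGroup.of (Multiplicative.ofAdd (⟨b', hb'⟩ : effDiv V Γ nonneg)) := by
  have key : (⟨a, ha⟩ : effDiv V Γ nonneg) + ⟨b', hb'⟩ = ⟨a', ha'⟩ + ⟨b, hb⟩ :=
    Subtype.ext (sub_eq_sub_iff_add_eq_add.mp h)
  rw [div_eq_div_iff_mul_eq_mul, ← map_mul Algebra.GrothendieckGroup.of,
    ← map_mul Algebra.GrothendieckGroup.of, ← ofAdd_add, ← ofAdd_add, key]

/-- The class of a family in `Φ(∗)^gp`: `D ↦ of(D⁺) · of(D⁻)⁻¹` — the identification of the group of all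
families `⊕_v Γ_v` with the groupification of the effective ones. ([IUTchIII] Ex 3.6 (ii) p.108) [claim: Mochizuki2012, status: disputed] -/
def toGpFun (D : FrakObj V Γ) : Algebra.GrothendieckGroup (EffDiv V Γ nonneg) :=
  Algebra.GrothendieckGroup.of (Multiplicative.ofAdd (⟨posPart H D, posPart_mem H D⟩ : effDiv V Γ nonneg)) /
    Algebra.GrothendieckGroup.of (Multiplicative.ofAdd (⟨negPart H D, negPart_mem H D⟩ : effDiv V Γ nonneg))

/-- `toGp D = of(a)/of(b)` for ANY effective `a, b` with `a - b = D`. ([IUTchIII] Ex 3.6 (ii) p.108) [claim: Mochizuki2012, status: disputed] -/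
theorem toGpFun_eq_div (D : FrakObj V Γ) {a b : FrakObj V Γ} (ha : a ∈ effDiv V Γ nonneg)
    (hb : b ∈ effDiv V Γ nonneg) (h : a - b = D) :
    toGpFun H D = Algebra.GrothendieckGroup.of (Multiplicative.ofAdd (⟨a, ha⟩ : effDiv V Γ nonneg)) /
        Algebra.GrothendieckGroup.of (Multiplicative.ofAdd (⟨b, hb⟩ : effDiv V Γ nonneg)) :=
  of_div_of_eq (posPart_mem H D) (negPart_mem H D) ha hb ((posPart_sub_negPart H D).trans h.symm)

/-- `toGp` of an effective family is its image under `of`. ([IUTchIII] Ex 3.6 (ii) p.108) [claim: Mochizuki2012, status: disputed] -/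
theorem toGpFun_of_mem {D : FrakObj V Γ} (hD : D ∈ effDiv V Γ nonneg) :
    toGpFun H D = Algebra.GrothendieckGroup.of (Multiplicative.ofAdd (⟨D, hD⟩ : effDiv V Γ nonneg)) := by
  rw [toGpFun_eq_div H D hD (effDiv V Γ nonneg).zero_mem (sub_zero D)]
  have : (Multiplicative.ofAdd (⟨0, (effDiv V Γ nonneg).zero_mem⟩ : effDiv V Γ nonneg)) = 1 := rfl
  rw [this, map_one, div_one]

/-- `toGp` is additive-to-multiplicative: the class map `⊕_v Γ_v → Φ(∗)^gp` as a monoid homomorphism.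
([IUTchIII] Ex 3.6 (ii) p.108) [claim: Mochizuki2012, status: disputed] -/
def toGp : Multiplicative (FrakObj V Γ) →* Algebra.GrothendieckGroup (EffDiv V Γ nonneg) where
  toFun D := toGpFun H (Multiplicative.toAdd D)
  map_one' := by
    show toGpFun H 0 = 1
    rw [toGpFun_of_mem H (effDiv V Γ nonneg).zero_mem]
    exact map_one _
  map_mul' x y := by
    show toGpFun H (Multiplicative.toAdd x + Multiplicative.toAdd y) =
      toGpFun H (Multiplicative.toAdd x) * toGpFun H (Multiplicative.toAdd y)
    rw [toGpFun_eq_div H (Multiplicative.toAdd x + Multiplicative.toAdd y)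
      ((effDiv V Γ nonneg).add_mem (posPart_mem H (Multiplicative.toAdd x))
        (posPart_mem H (Multiplicative.toAdd y)))
      ((effDiv V Γ nonneg).add_mem (negPart_mem H (Multiplicative.toAdd x))
        (negPart_mem H (Multiplicative.toAdd y)))
      (by rw [add_sub_add_comm, posPart_sub_negPart, posPart_sub_negPart])]
    unfold toGpFun
    rw [div_mul_div_comm, ← map_mul Algebra.GrothendieckGroup.of, ← map_mul Algebra.GrothendieckGroup.of,
      ← ofAdd_add, ← ofAdd_add]
    rfl

/-- `toGp` on `ofAdd D` is `toGpFun D`. ([IUTchIII] Ex 3.6 (ii) p.108) [claim: Mochizuki2012, status: disputed] -/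
theorem toGp_ofAdd (D : FrakObj V Γ) : toGp H (Multiplicative.ofAdd D) = toGpFun H D := rfl

/-- `toGp` is injective: `Φ(∗)` is cancellative and `of` is injective on it. ([IUTchIII] Ex 3.6 (ii) p.108) [claim: Mochizuki2012, status: disputed] -/
theorem toGp_injective : Function.Injective (toGp H) := by
  intro x y hxy
  have h : toGpFun H (Multiplicative.toAdd x) = toGpFun H (Multiplicative.toAdd y) := hxy
  unfold toGpFun at h
  rw [div_eq_div_iff_mul_eq_mul, ← map_mul Algebra.GrothendieckGroup.of,
    ← map_mul Algebra.GrothendieckGroup.of, ← ofAdd_add, ← ofAdd_add] at h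
  have h' : posPart H (Multiplicative.toAdd x) + negPart H (Multiplicative.toAdd y) =
      posPart H (Multiplicative.toAdd y) + negPart H (Multiplicative.toAdd x) :=
    congrArg Subtype.val (Multiplicative.ofAdd.injective (Algebra.GrothendieckGroup.of_injective h))
  have hx := posPart_sub_negPart H (Multiplicative.toAdd x)
  have hy := posPart_sub_negPart H (Multiplicative.toAdd y)
  have : Multiplicative.toAdd x = Multiplicative.toAdd y := by
    rw [← hx, ← hy]
    exact sub_eq_sub_iff_add_eq_add.mpr h'
  exact congrArg Multiplicative.ofAdd this

end ToGp

end GlobalFrobenioidModels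

end Literature.IUT.LogThetaLattice
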